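import Literature.AlgebraicGeometry.HodgeTheory.HomComplexCochains
import Literature.AlgebraicGeometry.HodgeTheory.HomComplexQuasiIso
import Literature.AlgebraicGeometry.HodgeTheory.DerivedDualityOfUnitAdjunction
import Literature.AlgebraicGeometry.Modules.ModulesGrothendieckAbelian
import Mathlib.Algebra.Homology.DerivedCategory.KInjective
import Mathlib.Algebra.Homology.Factorizations.CM5a
import HarnessLib

/-!
# The derived unit adjunction `Hom_D(E•, F•[k]) ≃ Hom_D(𝒪_X[0], 𝓗om•(E•, F•)[k])` for `E•` strictly perfect,
# and derived duality `Hom_D(F•^∨, E•^∨[k]) ≃ Hom_D(E•, F•[k])` for bounded vector-bundle complexes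

Layer `Literature/AlgebraicGeometry/HodgeTheory`; sequel to `HomComplexCochains.lean` (the isomorphism of cochain complexes of abelian groups
`cochainsIso : HomComplex E I ≅ HomComplex 𝒪_X[0] 𝓗om•(E•, I•)` for `E• ∈ [a, b]`), `HomComplexKInjective.lean` (`𝓗om•(E•, I•)` is K-injective for
`E•` strictly perfect and `I•` a bounded-below complex of injectives), `HomComplexQuasiIso.lean` (`𝓗om•(E•, –)` preserves quasi-isomorphisms for
`E•` strictly perfect) and `DerivedDualityOfUnitAdjunction.lean` (the socket reducing derived duality to the unit adjunction via brick B).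

* `HomComplex.homEquivQ K L : Hom_{K}(K, L) ≃ Hom_{D}(Q K, Q L)` for `L` K-injective (Mathlib `CochainComplex.IsKInjective.Qh_map_bijective`,
  Spaltenstein Prop. 1.5, composed with `quotient ⋙ Qh ≅ Q`);
* `HomComplex.shiftedHomEquivUnitOfInjective` — for `E• ∈ [a, b]` with finite locally free terms and `I•` a bounded-below complex of
  injective `𝒪_X`-modules: `Hom_D(Q E•, (Q I•)⟦k⟧) ≃ Hom_D(Q 𝒪_X[0], (Q 𝓗om•(E•, I•))⟦k⟧)` — both sides are `H^k` of ONE complex of abelian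
  groups: `Hom_D(Q E, (Q I)⟦k⟧) = Hom_K(E, I⟦k⟧)` (`I⟦k⟧` K-injective) `= CohomologyClass E I k` (Mathlib `HomComplex.CohomologyClass.homAddEquiv`)
  `= H^k(HomComplex E I)` (`homologyAddEquiv`) `≅ H^k(HomComplex 𝒪_X[0] 𝓗om•(E•, I•))` (`cochainsIso`) `= … = Hom_D(Q 𝒪_X[0], (Q 𝓗om•(E•, I•))⟦k⟧)`
  (`𝓗om•(E•, I•)⟦k⟧` K-injective, `HomComplex.isKInjective`);
* **`HomComplex.nonempty_shiftedHomEquivUnit` / `HomComplex.shiftedHomEquivUnit E a b hE F a' k`** — for `E• ∈ [a, b]` with finite locally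
  free terms and ANY bounded-below `F• ≥ a'`: `Hom_D(Q E•, (Q F•)⟦k⟧) ≃ Hom_D(Q 𝒪_X[0], (Q 𝓗om•(E•, F•))⟦k⟧)` — transport along an injective
  resolution `ι : F• → I•` (Mathlib `CochainComplex.Plus.modelCategoryQuillen.exists_quasiIso_injective`; `Q ι` and `Q 𝓗om•(E•, ι)` are
  isomorphisms, the latter by `HomComplex.quasiIso_map_of_bounded`). This is `R Hom(𝒪_X, R𝓗om(E•, F•)) = R Hom(E•, F•)` (Stacks, Cohomology of
  Sheaves, Lemma «global sections of internal hom», Tag 08DH ff.) with `R𝓗om(E•, F•)` computed by `𝓗om•(E•, F•)` because `E•` is strictly perfect;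
* **`HomComplex.nonempty_shiftedHom_dualComplexUnit_equiv`** — DERIVED DUALITY for bounded complexes `E• ∈ [a, b]`, `F• ∈ [a', b']` with finite
  locally free terms: `Nonempty (Hom_D(Q F•^∨, (Q E•^∨)⟦k⟧) ≃ Hom_D(Q E•, (Q F•)⟦k⟧))`, `(–)^∨ := 𝓗om•(–, 𝒪_X[0])` — the socket
  `nonempty_shiftedHom_dualComplexUnit_equiv_of_unitAdjunction` fed with `shiftedHomEquivUnit` at `(E•, F•)` and at `(F•^∨, E•^∨)`
  (`F•^∨ ∈ [-b', -a']` with finite locally free terms: `isStrictlyGE/LE_dualComplexUnit`, `isFiniteLocallyFree_dualComplexUnit_X`).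

Everything is proved; 0 named facts. Honest scope: a bijection of Hom-SETS is produced (no naturality in `E•`, `F•`, no compatibility with
composition or with the triangulated structure is asserted); written as piece (A)+(β3) of ROAD K of the Hodge-programme crux 26512 — a research
route conditional on HC_CM, NOT a corollary: nothing here says anything about (U-Σ)/(N-U)/26512/№4/HC_AV/HC.

## References

* The Stacks project, *Cohomology of Sheaves*, Sections «Hom complexes», «Internal hom in the derived category», «Strictly perfect complexes»
  (Tags 0A8K, 08DH, 08C3). [StacksProject]
* N. Spaltenstein, *Resolutions of unbounded complexes*, Compositio Math. 65 (1988), Prop. 1.5. [Spaltenstein1988]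
* C. A. Weibel, *An introduction to homological algebra* (1994), 2.7.4–2.7.5, §10.4, 10.7. [Weibel1994]
* R. Hartshorne, *Residues and Duality* / *Algebraic Geometry* III.6 (locally free duality `Ext^i(E ⊗ L^∨, F) = Ext^i(E, L ⊗ F)`). [Hartshorne1977]
-/

noncomputable section

open CategoryTheory CategoryTheory.Limits AlgebraicGeometry Opposite CochainComplex.HomComplex

universe w u

namespace Literature.AlgebraicGeometry.HodgeTheory

open Literature.AlgebraicGeometry.Modules Literature.AlgebraicGeometry.Motives

namespace HomComplex

variable (X : Scheme.{u}) [HasDerivedCategory.{w} X.Modules]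

/-! ## §1 Morphisms into a K-injective complex -/

/-- **`Hom_{K(𝒪_X)}(K, L) ≃ Hom_{D(𝒪_X)}(Q K, Q L)` for `L` K-injective** (the localisation functor `Qh` is bijective on morphisms INTO a
K-injective complex, Mathlib `CochainComplex.IsKInjective.Qh_map_bijective`; composed with `quotient ⋙ Qh ≅ Q`). [cite: Spaltenstein1988, Prop. 1.5] -/
def homEquivQ (K L : CochainComplex X.Modules ℤ) [L.IsKInjective] :
    ((HomotopyCategory.quotient X.Modules (ComplexShape.up ℤ)).obj K ⟶ (HomotopyCategory.quotient X.Modules (ComplexShape.up ℤ)).obj L) ≃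
      (DerivedCategory.Q.obj K ⟶ DerivedCategory.Q.obj L) :=
  (Equiv.ofBijective _ (CochainComplex.IsKInjective.Qh_map_bijective _ L)).trans
    (Iso.homCongr ((DerivedCategory.quotientCompQhIso X.Modules).app K) ((DerivedCategory.quotientCompQhIso X.Modules).app L))

/-- `Hom_D(T, (Q L)⟦k⟧) ≃ Hom_D(T, Q (L⟦k⟧))` (`Q` commutes with the shifts). [cite: Weibel1994, §10.4] -/
def shiftedHomEquivHomShift (T : DerivedCategory X.Modules) (L : CochainComplex X.Modules ℤ) (k : ℤ) :
    ShiftedHom T (DerivedCategory.Q.obj L) k ≃ (T ⟶ DerivedCategory.Q.obj (L⟦k⟧)) :=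
  Iso.homCongr (Iso.refl T) ((DerivedCategory.Q.commShiftIso k).app L).symm

/-! ## §2 The unit adjunction for an injective target -/

/-- **`Hom_D(Q E•, (Q I•)⟦k⟧) ≃ Hom_D(Q 𝒪_X[0], (Q 𝓗om•(E•, I•))⟦k⟧)` for `E• ∈ [a, b]` with finite locally free terms and `I•` a bounded-below
complex of injectives**: both sides are `H^k` of one complex of abelian groups — `Hom_K(E, I⟦k⟧) = CohomologyClass E I k = H^k(HomComplex E I)`
(Mathlib) `≅ H^k(HomComplex 𝒪_X[0] 𝓗om•(E•, I•))` (`cochainsIso`) `= Hom_K(𝒪_X[0], 𝓗om•(E•, I•)⟦k⟧)`, and `I⟦k⟧`, `𝓗om•(E•, I•)⟦k⟧` are K-injective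
(`HomComplex.isKInjective`). [cite: StacksProject, Cohomology of Sheaves, «Hom complexes» and «Internal hom in the derived category» (Tags 0A8K, 08DH)]
[cite: Spaltenstein1988, Prop. 1.5] [cite: Weibel1994, 2.7.4–2.7.5 and §10.4] -/
def shiftedHomEquivUnitOfInjective (E : CochainComplex X.Modules ℤ) (a b : ℤ) [E.IsStrictlyGE a] [E.IsStrictlyLE b]
    (hE : ∀ i, IsFiniteLocallyFree (E.X i)) (I : CochainComplex X.Modules ℤ) (c : ℤ) [I.IsStrictlyGE c] (hI : ∀ q, Injective (I.X q)) (k : ℤ) :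
    ShiftedHom (DerivedCategory.Q.obj E) (DerivedCategory.Q.obj I) k ≃
      ShiftedHom (DerivedCategory.Q.obj (single₀ X (unitModule X))) (DerivedCategory.Q.obj (homComplex X E I)) k :=
  haveI : I.IsKInjective := CochainComplex.isKInjective_of_injective I c
  haveI : (homComplex X E I).IsKInjective := isKInjective X a b c hE hI
  (shiftedHomEquivHomShift X _ I k).trans <|
    (homEquivQ X E (I⟦k⟧)).symm.trans <|
      (CohomologyClass.homAddEquiv (K := E) (L := I) (n := k)).toEquiv.symm.trans <|
        (homologyAddEquiv (K := E) (L := I) (n := k)).toEquiv.symm.trans <|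
          ((HomologicalComplex.homologyFunctor AddCommGrpCat (ComplexShape.up ℤ) k).mapIso
              (cochainsIso X E I a b)).addCommGroupIsoToAddEquiv.toEquiv.trans <|
            (homologyAddEquiv (K := (CochainComplex.singleFunctor X.Modules 0).obj (unitModule X)) (L := homComplex X E I)
                (n := k)).toEquiv.trans <|
              (CohomologyClass.homAddEquiv (K := (CochainComplex.singleFunctor X.Modules 0).obj (unitModule X)) (L := homComplex X E I)
                  (n := k)).toEquiv.trans <|
                (homEquivQ X _ ((homComplex X E I)⟦k⟧)).trans (shiftedHomEquivHomShift X _ (homComplex X E I) k).symm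

/-! ## §3 The unit adjunction for a bounded-below target -/

/-- **THE DERIVED UNIT ADJUNCTION `Hom_D(Q E•, (Q F•)⟦k⟧) ≃ Hom_D(Q 𝒪_X[0], (Q 𝓗om•(E•, F•))⟦k⟧)`** for `E• ∈ [a, b]` with finite locally free
terms (strictly perfect) and `F•` bounded below: transport of `shiftedHomEquivUnitOfInjective` along an injective resolution `ι : F• → I•`
(`Q ι` is an isomorphism; so is `Q 𝓗om•(E•, ι)` because `𝓗om•(E•, –)` preserves quasi-isomorphisms for `E•` strictly perfect). A bijection of
Hom-sets; no naturality asserted. [cite: StacksProject, Cohomology of Sheaves, «Internal hom in the derived category» and «Strictly perfect complexes»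
(Tags 08DH, 08C3)] [cite: Weibel1994, §10.4 and 10.7] -/
theorem nonempty_shiftedHomEquivUnit (E : CochainComplex X.Modules ℤ) (a b : ℤ) [E.IsStrictlyGE a] [E.IsStrictlyLE b]
    (hE : ∀ i, IsFiniteLocallyFree (E.X i)) (F : CochainComplex X.Modules ℤ) (a' : ℤ) [F.IsStrictlyGE a'] (k : ℤ) :
    Nonempty (ShiftedHom (DerivedCategory.Q.obj E) (DerivedCategory.Q.obj F) k ≃
      ShiftedHom (DerivedCategory.Q.obj (single₀ X (unitModule X))) (DerivedCategory.Q.obj (homComplex X E F)) k) := by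
  obtain ⟨I, ι, hι, hI, hIc⟩ := CochainComplex.Plus.modelCategoryQuillen.exists_quasiIso_injective F a'
  haveI := hι
  haveI : IsIso (DerivedCategory.Q.map ι) := by
    rw [DerivedCategory.isIso_Q_map_iff_quasiIso]; exact hι
  haveI : QuasiIso (map X E ι) := quasiIso_map_of_bounded X ι E a b hE
  haveI : IsIso (DerivedCategory.Q.map (map X E ι)) := by
    rw [DerivedCategory.isIso_Q_map_iff_quasiIso]; infer_instance
  exact ⟨(Iso.homCongr (Iso.refl _) ((shiftFunctor (DerivedCategory X.Modules) k).mapIso (asIso (DerivedCategory.Q.map ι)))).trans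
    ((shiftedHomEquivUnitOfInjective X E a b hE I a' hI k).trans
      (Iso.homCongr (Iso.refl _) ((shiftFunctor (DerivedCategory X.Modules) k).mapIso (asIso (DerivedCategory.Q.map (map X E ι))))).symm)⟩

/-- **`shiftedHomEquivUnit E a b hE F a' k : Hom_D(Q E•, (Q F•)⟦k⟧) ≃ Hom_D(Q 𝒪_X[0], (Q 𝓗om•(E•, F•))⟦k⟧)`** — a choice of the bijection of
`nonempty_shiftedHomEquivUnit` (the signature agreed for piece (A) of ROAD K). [cite: StacksProject, Cohomology of Sheaves, «Internal hom in the
derived category» (Tag 08DH)] [cite: Weibel1994, §10.4 and 10.7] -/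
def shiftedHomEquivUnit (E : CochainComplex X.Modules ℤ) (a b : ℤ) [E.IsStrictlyGE a] [E.IsStrictlyLE b] (hE : ∀ i, IsFiniteLocallyFree (E.X i))
    (F : CochainComplex X.Modules ℤ) (a' : ℤ) [F.IsStrictlyGE a'] (k : ℤ) :
    ShiftedHom (DerivedCategory.Q.obj E) (DerivedCategory.Q.obj F) k ≃
      ShiftedHom (DerivedCategory.Q.obj (single₀ X (unitModule X))) (DerivedCategory.Q.obj (homComplex X E F)) k :=
  Classical.choice (nonempty_shiftedHomEquivUnit X E a b hE F a' k)

/-! ## §4 Derived duality for bounded vector-bundle complexes -/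

/-- **DERIVED DUALITY `Hom_D(Q F•^∨, (Q E•^∨)⟦k⟧) ≃ Hom_D(Q E•, (Q F•)⟦k⟧)`** for bounded complexes `E• ∈ [a, b]`, `F• ∈ [a', b']` of
`𝒪_X`-modules with finite locally free terms, `(–)^∨ := 𝓗om•(–, 𝒪_X[0])`: the socket `nonempty_shiftedHom_dualComplexUnit_equiv_of_unitAdjunction`
(brick B, the transpose `𝓗om•(F•^∨, E•^∨) ≅ 𝓗om•(E•, F•)`, through `Q`) fed with the derived unit adjunction `shiftedHomEquivUnit` at `(E•, F•)` and at
`(F•^∨, E•^∨)` (`F•^∨ ∈ [-b', -a']` has finite locally free terms). A bijection of Hom-sets (no naturality asserted).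
[cite: Hartshorne1977, III.6 (Prop. 6.7: locally free duality)] [cite: StacksProject, Cohomology of Sheaves, «Internal hom in the derived category»
and «Strictly perfect complexes» (Tags 08DH, 08C3)] [cite: Weibel1994, §10.4 and 2.7.4–2.7.5] -/
theorem nonempty_shiftedHom_dualComplexUnit_equiv (E F : CochainComplex X.Modules ℤ) (a b a' b' : ℤ) [E.IsStrictlyGE a] [E.IsStrictlyLE b]
    [F.IsStrictlyGE a'] [F.IsStrictlyLE b'] (hE : ∀ i, IsFiniteLocallyFree (E.X i)) (hF : ∀ i, IsFiniteLocallyFree (F.X i)) (k : ℤ) :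
    Nonempty (ShiftedHom (DerivedCategory.Q.obj (homComplex X F (single₀ X (unitModule X))))
        (DerivedCategory.Q.obj (homComplex X E (single₀ X (unitModule X)))) k ≃
      ShiftedHom (DerivedCategory.Q.obj E) (DerivedCategory.Q.obj F) k) :=
  haveI := isStrictlyGE_dualComplexUnit X F b'
  haveI := isStrictlyLE_dualComplexUnit X F a'
  haveI := isStrictlyGE_dualComplexUnit X E b
  nonempty_shiftedHom_dualComplexUnit_equiv_of_unitAdjunction X E F k hE hF (shiftedHomEquivUnit X E a b hE F a' k)
    (shiftedHomEquivUnit X (homComplex X F (single₀ X (unitModule X))) (-b') (-a') (isFiniteLocallyFree_dualComplexUnit_X X F hF)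
      (homComplex X E (single₀ X (unitModule X))) (-b) k)

end HomComplex

end Literature.AlgebraicGeometry.HodgeTheory

end
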